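/-
Copyright (c) 2026 the pub-hodgecm-mathlib formalisation cell (harness21).  Prover seat hodgecm-mathlib-B-p14 (g30), (L3) second pen under A-p03 (g24);
LEAD F0P3a-plan (g9) WORD T8-36 (C) «(L3)», architect A-p06 (g26) (MAP v2 WANT 2–5), 2026-09-01.
-/
import Mathlib.Tactic
import HarnessLib

/-!
# Flicker's unit orbital integrals for `U(3)` at an inert place, TORUS TYPE (2) `T ≃ (EL)¹ × E¹` — THE PRINTED CLOSED FORMS
# (Canad. J. Math. 50 (1998), Prop. 11 (second half) p. 87, Prop. 17 p. 97, Theorem 18 p. 97)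

Topic `NumberTheory/Rogawski1990` (road «D-N7-inert», letter N7-ns = [Rogawski1990, Prop. 4.9.1 (b)] at the inert places); namespace
`Literature.NumberTheory.Rogawski1990.Flicker1998`.  DEFINITIONS ONLY (four computable `def`s = the printed closed forms; no theorem, no instance,
no notation, no named fact, no `sorry`); the algebra (Theorem 18) is the sequel `UnitFundamentalLemmaInertFlickerAlgebraTypeTwo`; the orbital-integral
VALUES letter (the lattice counts themselves) is «(L3-V)», cited not proved.  Companion of ★ `UnitOrbitalIntegralInertClosedForms` (A-p03 (g24): torus type (1)
`T = (E¹)³`, Props. 11 (first half), 14, Theorem 15).  Cell `pub/hodgecm-mathlib`, crux H413 = `stmt-HodgeConjecture-24833`.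

THE MATHEMATICS [Flicker1998UnitaryFL].  `E = F(√D)∕F` the unramified quadratic extension of `p`-adic fields (`p ≠ 2`, `D ∈ R^× − R^{×2}`), `q` the residual
cardinality of `F`, `π` a uniformiser, `L = F(√π)` (ramified), `G = U(2,1; E∕F)`, `K` its standard hyperspecial subgroup (`vol K = 1`), `H = U(1,1) × U(1) =
Z_G(diag(1,−1,1))`, `K_H` hyperspecial (`vol K_H = 1`).  Prop. 3 (p. 78): the conjugacy classes of tori `≃ (LE)¹ × E¹` in the stable class are represented by
`T_H = {δ⁻¹ (β, πα∕√D; α√D, β) : δ ∈ E¹, β² − πα² = 1} × E¹ ⊂ H ⊂ G` and `T_{H′} = {δ⁻¹ (β, πα; α, β)} × E¹ ⊂ H′ ⊂ G′ = g⁻¹Gg`; the stable class of a regular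
`t ∈ T_H` consists of TWO classes, `t` and `t″ = g t′ g⁻¹` (`t′ ∈ T_{H′}`) — the type-(2) local class set of order 2 (cf. ★ `Rogawski1990.ncard_conjClassesIn_eq_two`).
Normalising by the centre `E¹ ⊂ K`, `t = (t₁, 1) ∈ (EL)¹ × E¹`; the invariants are (Prop. 16 p. 96, proof of Thm. 18 p. 97) **`α = B π^N`** (`B ∈ R^×`) and
`δ = δ₁ + √D δ₂` with **`δ₂ = D₂ π^{1+N₂}`** (`D₂ ∈ R^×`), so that `t₁ − 1 = B π^N √π − √D D₂ π^{1+N₂} + …` and `t₁ − 1 ∈ π_{EL}^n R_{EL}^×` with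
**`n = min(1 + 2N, 2 + 2N₂)`**.  Flicker computes, by the double-coset decompositions of Props. 4–6 and explicit volumes (Props. 10, 16), the CLOSED FORMS
* `Φ(t) = ∫_{T_H∖G} 1_K(x⁻¹ t x) dx` = **Prop. 11, second half (p. 87)** — recorded as `phiTH q N₂ N`;
* `Φ′(t) = ∫_{Z_G(t″)∖G} 1_K(x⁻¹ t″ x) dx` = **Prop. 17 (p. 97)** (`= Σ_{0 ≤ m ≤ min([N∕2],[N₂∕2])} (q+1)q^{4m} + δ(N ≤ N₂) Σ_{[N∕2] < m ≤ N} (q+1)q^{N+2m}` by Prop. 16)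
  — recorded as `phiTHprime q N₂ N`;
* the `κ`-orbital integral `Φ^κ_{1_K}(t) = Φ(t) − Φ′(t)` (p. 97) — `phiKappaTwo`;
* the H-side `Φ^st_{1_{K_H}}(t) = Φ_H(t)` (p. 97: «the stable conjugacy class of `t` in `H` consists of a single conjugacy class») — `phiHtwo q N`.
READING NOTE on `Φ_H`.  Page 97 prints «`Φ_H(t) = (q^N − 1)∕(q − 1)`, where `N` is defined in Proposition 16», while the PROOF of Theorem 18 on the same page
uses `(q^{N+1} − 1)∕(q − 1)` (twice: «if `N ≤ N₂` … `Φ^κ_{1_K}(t) = −q^{1+2N}(q^{N+1} − 1)∕(q − 1)`; when `N₂ < N` … `= q^{2+2N₂}(q^{N+1} − 1)∕(q − 1)`»).  With `N` as in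
Prop. 16 (`α = Bπ^N`, `N ≥ 0`) the consistent reading is **`Φ_H(t) = (q^{N+1} − 1)∕(q − 1)`**: under it Props. 11, 17 and Theorem 18 agree identically in
`(q, N, N₂)` — this is PROVED in the sequel (`flicker_theorem18`, all `N, N₂ : ℕ`, `q > 1`) and was checked beforehand in exact arithmetic on all 256 triples
`q ∈ {3,5,7,9}`, `N, N₂ ≤ 7` (0 exceptions; with `q^N` instead: 256 exceptions) — so `phiHtwo q N := (q^{N+1} − 1)∕(q − 1)`.  (Tree count: it is the number
`1 + q + ⋯ + q^N` of `t₁`-fixed hyperspecial vertices in the tree of `U(1,1)`, [LR] p. 360.)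
THEOREM 18 (p. 97): `Δ_{G∕H}(t) Φ^κ_{1_K}(t) = Φ^st_{1_{K_H}}(t)` with `Δ_{G∕H}(t) = (−q)^{−n}` — on the closed forms the PURE ALGEBRAIC IDENTITY
`φ_{T_H}(N₂, N) − φ′_{T_H}(N₂, N) = (−q)^{min(1+2N, 2+2N₂)} · (q^{N+1} − 1)∕(q − 1)` for ALL `N, N₂ ≥ 0` (no side condition, unlike type (1)), i.e.
`Φ^κ = −q^{1+2N} Φ_H` if `N ≤ N₂` and `Φ^κ = q^{2+2N₂} Φ_H` if `N₂ < N` — kernel-checked in the sequel; it is (a) Flicker's Theorem 18 in the tree and (b) the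
CONSISTENCY CERTIFICATE of this transcription (parities `N` odd∕even in (1), `N₂` even∕odd in (2) of Prop. 11 as printed).
HONEST LABEL: HC_CM is proved only modulo the printed citations until rung 0 closes; this file is arithmetic and pays no letter by itself.

## References
* [Flicker1998UnitaryFL] Y. Z. Flicker, *Elementary proof of the fundamental lemma for a unitary group*, Canad. J. Math. 50 (1998), 74–98: Prop. 3 p. 78, Prop. 5
  p. 82, Props. 10–11 pp. 85–87, Props. 16–17 pp. 96–97, Theorem 18 p. 97.
* [Rogawski1990] J. D. Rogawski, *Automorphic Representations of Unitary Groups in Three Variables*, Ann. of Math. Stud. 123 (1990), §4.9 Prop. 4.9.1 (b) p. 55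
  («the "other" endoscopic fundamental lemma», the torus `T_K × E¹`).
* [BlasiusRogawski1992FL] D. Blasius, J. D. Rogawski, *Fundamental lemmas for U(3) and related groups*, CRM Montréal (1992), 363–394 (the same lemma; Flicker p. 75:
  the `EL`-case count is Kottwitz's, [LR] p. 360).
-/


namespace Literature.NumberTheory.Rogawski1990.Flicker1998

/-! ## §1 The printed closed forms, torus type (2) -/

/-- **Flicker's `Φ(t) = ∫_{T_H∖G} 1_K(x⁻¹tx) dx` for a regular `t ∈ T_H ≃ (EL)¹ × E¹`** (Prop. 11, second half, p. 87), as a function of the residual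
cardinality `q` and the invariants `(N₂, N)` (`α = Bπ^N`, `δ₂ = D₂π^{1+N₂}`): (1) if `N ≤ N₂`: `(q^{2N+2} − 1)∕((q²+1)(q−1))` if `N` is odd,
`(q^{2N+4} − 1)∕((q²+1)(q−1)) − q^{1+2N}` if `N` is even; (2) if `N₂ < N`: `q^{N+2N₂+3}∕(q−1) − (q^{2N₂+2} + 1)∕((q²+1)(q−1))` if `N₂` is even,
`q^{N+2N₂+3}∕(q−1) − (q^{2N₂+4} + 1)∕((q²+1)(q−1))` if `N₂` is odd.  [cite: Flicker1998UnitaryFL, Prop. 11 p. 87] -/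
def phiTH (q N₂ N : ℕ) : ℚ :=
  if N ≤ N₂ then
    (if N % 2 = 1 then ((q : ℚ) ^ (2 * N + 2) - 1) / (((q : ℚ) ^ 2 + 1) * ((q : ℚ) - 1))
      else ((q : ℚ) ^ (2 * N + 4) - 1) / (((q : ℚ) ^ 2 + 1) * ((q : ℚ) - 1)) - (q : ℚ) ^ (1 + 2 * N))
  else
    (if N₂ % 2 = 0 then (q : ℚ) ^ (N + 2 * N₂ + 3) / ((q : ℚ) - 1) - ((q : ℚ) ^ (2 * N₂ + 2) + 1) / (((q : ℚ) ^ 2 + 1) * ((q : ℚ) - 1))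
      else (q : ℚ) ^ (N + 2 * N₂ + 3) / ((q : ℚ) - 1) - ((q : ℚ) ^ (2 * N₂ + 4) + 1) / (((q : ℚ) ^ 2 + 1) * ((q : ℚ) - 1)))

/-- **Flicker's `Φ′(t) = ∫_{Z_G(t″)∖G} 1_K(x⁻¹t″x) dx` at the stably conjugate, non-conjugate class `t″ = g t′ g⁻¹`, `t′ ∈ T_{H′} ⊂ H′ ⊂ G′`**
(Prop. 17 p. 97, «the last orbital integral of Proposition 5»): `(q^{4+4·min([N∕2],[N₂∕2])} − 1)∕((q²+1)(q−1)) + δ(N ≤ N₂)·q^N (q^{2N+2} − q^{2[N∕2]+2})∕(q−1)`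
(floors `[x∕2]` = `Nat` division).  [cite: Flicker1998UnitaryFL, Prop. 17 p. 97] -/
def phiTHprime (q N₂ N : ℕ) : ℚ :=
  ((q : ℚ) ^ (4 + 4 * min (N / 2) (N₂ / 2)) - 1) / (((q : ℚ) ^ 2 + 1) * ((q : ℚ) - 1)) +
    (if N ≤ N₂ then (q : ℚ) ^ N * ((q : ℚ) ^ (2 * N + 2) - (q : ℚ) ^ (2 * (N / 2) + 2)) / ((q : ℚ) - 1) else 0)

/-- **The H-side value** `Φ^st_{1_{K_H}}(t) = Φ_H(t) = (q^{N+1} − 1)∕(q − 1)` (p. 97; one class in the stable class of `t` in `H = U(1,1) × U(1)`).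
ERRATUM ∕ CONVENTION LINE: `N` here is Prop. 16's `N` (`ε = α = Bπ^N`, `B ∈ R^×`); in that normalisation Flicker's `Φ_H(t)` is `(q^{N+1} − 1)∕(q − 1)` — the value
the PROOF of Theorem 18 uses on p. 97 (ll. −5∕−4: «`−q^{1+2N}(q^{N+1} − 1)∕(q − 1)`», «`q^{2+2N₂}(q^{N+1} − 1)∕(q − 1)`») — whereas p. 97 l. −9 prints «`(q^N − 1)∕(q − 1)`»;
with `q^{N+1}` Props. 11, 17 and Theorem 18 agree identically (proved in the sequel, `flicker_theorem18`; exact table 0∕256 exceptions, all 256 fail with `q^N`).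
The (F9)-ramified H-side pen states its lattice count with THIS `N`.  [cite: Flicker1998UnitaryFL, p. 97 (before Theorem 18, and its proof)] -/
def phiHtwo (q N : ℕ) : ℚ := ((q : ℚ) ^ (N + 1) - 1) / ((q : ℚ) - 1)

/-- **Flicker's `κ`-orbital integral of `1_K` on the stable class of a regular `t ∈ T_H`**, read on the closed forms: `Φ^κ_{1_K}(t) = Φ(t) − Φ′(t)`
(p. 97: «the difference of `Φ(t) = ∫_{T_H∖G} 1_K(x⁻¹tx) dx` and `Φ′(t) = ∫_{Z_G(t″)∖G} 1_K(x⁻¹t″x) dx`»).  [cite: Flicker1998UnitaryFL, p. 97] -/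
def phiKappaTwo (q N₂ N : ℕ) : ℚ := phiTH q N₂ N - phiTHprime q N₂ N

/-! ## §2 (ED. 2) The closed forms re-indexed by `(M, N)`, `M = N₂ + 1` — total on `ℕ²`, including the boundary stratum `M = 0`

For `γ_H = (g, u)` of torus type (2) the intrinsic exponents are `N` (`ord_w disc χ_g = 2N + 1`) and `M := ord_w(tr g − 2u)` (so that `n = ord_w χ_g(u) =
min(2N+1, 2M)`); Flicker's `N₂` is `M − 1` and his formulas presuppose `M ≥ 1` (`δ₂ = D₂π^{1+N₂}`).  The stratum `M = 0` (`χ_g(u)` a unit: `u ≢ λ (mod 𝔭_{EL})`)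
lies inside the line's `stub_countIrredClause` (it is not residually regular: `λ ≡ λ′ (mod π_{EL})` always); there only the `m = 0` terms of Prop. 10 survive and
Prop. 16's congruence has no solution, so `Φ(t) = Σ_{j ≤ N} q^j = (q^{N+1} − 1)∕(q − 1) = Φ_H(t)`, `Φ′(t″) = 0`, `Δ = (−q)^0 = 1` — which is what the printed
closed forms give when read at «`N₂ = −1`» with floor conventions.  The two definitions below are those total extensions; for `M ≥ 1` they are `phiTH q (M−1) N`,
`phiTHprime q (M−1) N` (proved in the sequel, with THEOREM 18 for all `(M, N)`). -/

/-- **`Φ(t)` for `t ∈ T_H`, indexed by `(M, N)`, `M = N₂ + 1`** (Prop. 11 second half, extended to the boundary `M = 0`): if `N < M` (`N ≤ N₂`):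
`(q^{2N+2} − 1)∕((q²+1)(q−1))` (`N` odd), `(q^{2N+4} − 1)∕((q²+1)(q−1)) − q^{1+2N}` (`N` even); if `M ≤ N` (`N₂ < N`): `q^{N+2M+1}∕(q−1) − (q^{2M} + 1)∕((q²+1)(q−1))`
(`M` odd, i.e. `N₂` even), `q^{N+2M+1}∕(q−1) − (q^{2M+2} + 1)∕((q²+1)(q−1))` (`M` even, i.e. `N₂` odd — at `M = 0`: `(q^{N+1} − 1)∕(q − 1)`).
[cite: Flicker1998UnitaryFL, Prop. 11 p. 87] -/
def phiTHM (q M N : ℕ) : ℚ :=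
  if N < M then
    (if N % 2 = 1 then ((q : ℚ) ^ (2 * N + 2) - 1) / (((q : ℚ) ^ 2 + 1) * ((q : ℚ) - 1))
      else ((q : ℚ) ^ (2 * N + 4) - 1) / (((q : ℚ) ^ 2 + 1) * ((q : ℚ) - 1)) - (q : ℚ) ^ (1 + 2 * N))
  else
    (if M % 2 = 1 then (q : ℚ) ^ (N + 2 * M + 1) / ((q : ℚ) - 1) - ((q : ℚ) ^ (2 * M) + 1) / (((q : ℚ) ^ 2 + 1) * ((q : ℚ) - 1))
      else (q : ℚ) ^ (N + 2 * M + 1) / ((q : ℚ) - 1) - ((q : ℚ) ^ (2 * M + 2) + 1) / (((q : ℚ) ^ 2 + 1) * ((q : ℚ) - 1)))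

/-- **`Φ′(t″)` indexed by `(M, N)`, `M = N₂ + 1`** (Prop. 17, extended to `M = 0`): `(q^{4·min([N∕2]+1, [(M+1)∕2])} − 1)∕((q²+1)(q−1)) + δ(N < M)·q^N(q^{2N+2} − q^{2[N∕2]+2})∕(q−1)`
(`min([N∕2],[N₂∕2]) + 1 = min([N∕2]+1, [(M+1)∕2])`; at `M = 0` the value is `0`).  [cite: Flicker1998UnitaryFL, Prop. 17 p. 97] -/
def phiTHprimeM (q M N : ℕ) : ℚ :=
  ((q : ℚ) ^ (4 * min (N / 2 + 1) ((M + 1) / 2)) - 1) / (((q : ℚ) ^ 2 + 1) * ((q : ℚ) - 1)) +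
    (if N < M then (q : ℚ) ^ N * ((q : ℚ) ^ (2 * N + 2) - (q : ℚ) ^ (2 * (N / 2) + 2)) / ((q : ℚ) - 1) else 0)

/-! ## §3 (ED. 3) Thin wrappers indexed by the two OBSERVABLE exponents `(n, N)` (architect A-p06 (g26) 04:46Z)

`n = ord_w χ_g(u)` ((D2)'s exponent) and `N` (`ord_w disc χ_g = 2N+1`) are read off `γ_H` directly; `M = ord_w(tr g − 2u)` may be infinite (`tr g = 2u`) and enters only
through `min M (N+1)`: the law is `n ≤ 2N + 1` with `n` EVEN unless `n = 2N + 1`, and then `M := n∕2` (even case) resp. any `M > N` (odd case) indexes the same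
values.  The registered value stubs of the line use these wrappers. -/

/-- `Φ(t)` (`κ = +1` class) indexed by the observable exponents `(n, N)`: `phiTHM q M N` at `M := n∕2` if `n` is even, `M := N + 1` otherwise.
[cite: Flicker1998UnitaryFL, Prop. 11 p. 87; Theorem 18 p. 97] -/
def phiTHn (q n N : ℕ) : ℚ := phiTHM q (if n % 2 = 0 then n / 2 else N + 1) N

/-- `Φ′(t″)` (`κ = −1` class) indexed by the observable exponents `(n, N)`: `phiTHprimeM q M N` at `M := n∕2` if `n` is even, `M := N + 1` otherwise.
[cite: Flicker1998UnitaryFL, Prop. 17 p. 97; Theorem 18 p. 97] -/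
def phiTHprimen (q n N : ℕ) : ℚ := phiTHprimeM q (if n % 2 = 0 then n / 2 else N + 1) N

/-! ## §4 (ED. 4) Proposition 16's per-`m` values, `(M, N)`-indexed — the summands of `Φ′(t″)` (LAYER B′ target of the `κ = −1` value stub) -/

/-- **Prop. 16's value of `∫_{H′∕H′_m} 1_{H′_m}(h⁻¹t′h) dh`** (the number of `t′`-fixed cosets in `H″ ⧸ H′_m` over the `m`-th anisotropic double coset), indexed
by `(M, N)`, `M = N₂ + 1`: `(q+1)q^{4m}` if `M ≥ 1` and `m ≤ min([N∕2],[N₂∕2])`; `(q+1)q^{N+2m}` if `N < M` (`N ≤ N₂`) and `[N∕2] < m ≤ N`; `0` otherwise (in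
particular identically `0` on the boundary stratum `M = 0`, where Prop. 16's congruence has no solution).  `Σ_m iSixteenM = phiTHprimeM` is Prop. 17 (sequel).
[cite: Flicker1998UnitaryFL, Prop. 16 p. 96; Prop. 17 p. 97] -/
def iSixteenM (q M N m : ℕ) : ℚ :=
  if 1 ≤ M ∧ m ≤ min (N / 2) ((M - 1) / 2) then ((q : ℚ) + 1) * (q : ℚ) ^ (4 * m)
  else if N < M ∧ N / 2 < m ∧ m ≤ N then ((q : ℚ) + 1) * (q : ℚ) ^ (N + 2 * m)
  else 0

end Literature.NumberTheory.Rogawski1990.Flicker1998
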